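import Summits.BirchSwinnertonDyer.BirchSwinnertonDyer.Theorems.ResidualThetaTransportAtTwoResidualSignedLambdaLowerCMAtTwoRhoLayerPairingTower
import Literature.NumberTheory.EllipticCurves.Kato2004.UniversalNormsCoeffFramed
import HarnessLib

/-!
# H-C (LIM_ρ): `H¹(U, T_ρ) → lim←_k H¹(U, A_ρ[p^k])` is ONTO for a framed representation `ρ : Γ_ℚ → GL_d(𝒪)` with
# compact coefficients `𝒪 = padicCoeffIntegers S` — Rubin, *Euler Systems*, App. B Prop. B.2.3 (surjectivity half) for `T_ρ = 𝒪ᵈ`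

Route `ResidualThetaTransportAtTwo` (RTT), crux RSL_g `ResidualSignedLambdaLowerCMAtTwo` (stmt-BirchSwinnertonDyer-22608); seat
`prover-bsd-wall-tp2-p2x` g17 (`--supports`, closes nothing). THEOREMS ONLY (no definition, no named fact, no instance, no `sorry`). This is
item **H-C** of `Cruxes/ResidualThetaCountLowerPureAtTwo/STUB-PLAN-stub_cmLambdaLower.md` rev 14 §6 Q59 (card `stub-cmlambdalower-k3-g10`,
sketch `Sketch_sidea_k3_g10.lean` §B `CofreeReductionLimSurjective`): the input `hlim` of the Kőnig bookkeeping `CofreeLimitFamilyOfLevelwise` of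
the deep half (items S4₀ / S4₂), DISCHARGED for every subgroup `U ≤ Γ_ℚ` under `[CompactSpace 𝒪]` (equivalently `[FiniteDimensional ℚ_[p] ℚ_p(S)]`,
`UniversalNorms.compactSpace_padicCoeffIntegers`). The injectivity half (H-D, SEP_ρ) is `GreenbergSelmer.eq_of_forall_reduceH1CofreePkTorsion_eq`
(`Literature/…/GreenbergSelmerCofreeReductionSeparated.lean`); together: `H¹(U, T_ρ) ≅ lim←_k H¹(U, A_ρ[p^k])`.

## Contents (all PROVED; the `ρ`-coefficient twin of `Kato2004/IwasawaH1ReductionSurjectiveProofs.lean`, same proof on explicit cocycles)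

* §1 COMP_ρ: `exists_forall_divPowCofreeMkTorsion_eq_of_compatible` — every `[p]`-compatible sequence `a_k ∈ A_ρ[p^k]` is
  `(p^{-k} t mod 𝒪ᵈ)_k` for ONE `t ∈ T_ρ = 𝒪ᵈ` (Cantor's intersection theorem in the compact `𝒪ᵈ`: the fibres of `t ↦ p^{-k}t mod 𝒪ᵈ`
  over the `a_k` are closed, non-empty and decreasing); `eq_zero_of_forall_divPowCofreeMkTorsion_eq_zero` — and `t` is unique
  (`⋂_k p^k 𝒪ᵈ = 0`: `p^k s_k → 0`). I.e. `T_ρ = lim←_k A_ρ[p^k]` along `[p]`.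
* §2 `continuous_of_forall_continuous_divPowCofreeMkTorsion_comp` — a map into `𝒪ᵈ` all of whose residues `p^{-k}(·) mod 𝒪ᵈ` are
  continuous (= locally constant) is continuous (`p^k 𝒪ᵈ → 0`).
* §3 `exists_contOneCocycles_tower_of_compatible` — GENERIC exact lifting of cocycle representatives along an `ℕ`-tower of
  topological `G`-modules with surjective transition maps (the cochain content of NSW (2.7.5) in degree one).
* §4 **`exists_forall_reduceH1CofreePkTorsion_eq_of_compatible`** (Rubin B.2.3 (i), `i = 1`, surjectivity; NSW (2.7.5)): for every
  `U ≤ Γ_ℚ` and every family `c_k ∈ H¹(U, A_ρ[p^k])` with `[p]_* c_{k+1} = c_k` (`ThetaTransport.cofreeTorsionPow`) there is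
  `x ∈ H¹(U, T_ρ)` with `red_{p^k} x = c_k` (`GreenbergSelmer.reduceH1CofreePkTorsion`) for all `k` — VERBATIM the body of the sketch's
  `CofreeReductionLimSurjective S ρ U`; `…_of_finiteDimensional` (the newform habitat's standing hypothesis);
  `cohomologyMap_cofreeTorsionPow_reduceH1CofreePkTorsion_succ` — conversely the reductions of one class ARE `[p]_*`-compatible.
  Proof: choose representatives, correct them level by level by principal crossed homomorphisms so that `[p] ∘ φ_{k+1} = φ_k` ON THE NOSE
  (`[p] : A_ρ[p^{k+1}] → A_ρ[p^k]` is onto), then assemble the `T_ρ`-valued cocycle componentwise by §1 (cocycle identity by uniqueness,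
  continuity by §2).

## References

* K. Rubin, *Euler Systems*, Ann. of Math. Stud. 147 (2000), App. B §2, Prop. B.2.3. [Rubin2000]
* J. Neukirch, A. Schmidt, K. Wingberg, *Cohomology of Number Fields*, 2nd ed. (2008), II §7 Thm. (2.7.5). [NeukirchSchmidtWingberg2008]
* K. Kato, Astérisque 295 (2004), §8.2 (p. 181), §13.8 (pp. 228–229). [Kato2004Asterisque]
* R. Greenberg, *Iwasawa theory for p-adic representations*, Adv. Stud. Pure Math. 17 (1989), §1 p. 98 (`A_p = V_p/T_p`). [Greenberg1989]
* Tree: `Kato2004/IwasawaH1ReductionSurjectiveProofs.lean` (the `T_pW` twin `Kato2004.exists_reduceH1Pk_eq_of_compatible`),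
  `GreenbergSelmerCofreeReductionPk{,Proofs}.lean` (`divPowCofreeMk(Torsion)`, `reduceH1CofreePkTorsion`, kernel / image / `eq_iff`),
  `Kato2004/UniversalNormsCoeffFramed.lean` (`compactSpace_padicCoeffIntegers`, `tendsto_pow_smul_pi_padicCoeffIntegers`),
  `GreenbergSelmerCofreeReductionSeparated.lean` (H-D), `Theorems/…RhoLayerPairingCompat.lean` / `…Tower.lean` (`cofreeTorsionPow`,
  `cofreeTorsionPow_divPowCofreeMkTorsion`, `reduceH1CofreePkTorsion_oneCocycleClass'`).

BSD is not proved by any of this; RSL_g (22608) is not proved here.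
-/

set_option autoImplicit false
-- the Theorems namespace of this sub repeats the summit name by design (D-0017 nested layout)
set_option linter.dupNamespace false

noncomputable section

open scoped Classical

namespace Summit.BirchSwinnertonDyer.BirchSwinnertonDyer.Theorems.ThetaTransport

open CategoryTheory Field Filter Topology
  Literature.NumberTheory.EllipticCurves Literature.NumberTheory.GaloisRepresentations
  Literature.NumberTheory.EllipticCurves.GreenbergSelmer
  Literature.NumberTheory.EllipticCurves.Kato2004

variable {p : ℕ} [Fact p.Prime] (S : Set (PadicAlgCl p)) {d : ℕ} (ρ : FramedGaloisRep ℚ ↥(padicCoeffIntegers S) d)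

/-! ## §1 COMP_ρ: `T_ρ = 𝒪ᵈ` is the inverse limit of the `A_ρ[p^k]` along `[p]` -/

/-- `[p] : A_ρ[p^{k+1}] → A_ρ[p^k]` is onto (`T_ρ → A_ρ[p^{k+1}]` is onto and `[p] ∘ div_{k+1} = div_k`). Private helper.
[cite: Greenberg1989, §1 p. 98] -/
private theorem exists_cofreeTorsionPow_hom_eq (k : ℕ)
    (a : ↥(AddSubgroup.torsionBy (Cofree ρ ↥(padicCoeffField S)) ((p ^ k : ℕ) : ℤ))) :
    ∃ a' : ↥(AddSubgroup.torsionBy (Cofree ρ ↥(padicCoeffField S)) ((p ^ (k + 1) : ℕ) : ℤ)), (cofreeTorsionPow S ρ k).hom a' = a := by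
  obtain ⟨t, ht⟩ := divPowCofreeMkTorsion_surjective S ρ k a
  exact ⟨divPowCofreeMkTorsion S ρ (k + 1) t, by rw [cofreeTorsionPow_divPowCofreeMkTorsion, ht]⟩

/-- **COMP_ρ (completeness): every `[p]`-compatible sequence `a_k ∈ A_ρ[p^k]` (`[p] a_{k+1} = a_k`) is the sequence of residues
`p^{-k} t mod 𝒪ᵈ` of ONE `t ∈ T_ρ = 𝒪ᵈ`**, for compact `𝒪` (e.g. the integers of a finite `ℚ_p(S)/ℚ_p`). Cantor's intersection
theorem: the fibres `{t | p^{-k}t ≡ a_k}` are closed (the residue maps are continuous into discrete spaces), non-empty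
(`divPowCofreeMkTorsion_surjective`) and decreasing (`[p] ∘ div_{k+1} = div_k`). This is the `proj_lift` half of "`T_p = lim← A_p[p^k]`".
[cite: Greenberg1989, §1 p. 98] [cite: NeukirchSchmidtWingberg2008, II §7 (2.7.5)] -/
theorem exists_forall_divPowCofreeMkTorsion_eq_of_compatible [CompactSpace ↥(padicCoeffIntegers S)]
    (a : ∀ k : ℕ, ↥(AddSubgroup.torsionBy (Cofree ρ ↥(padicCoeffField S)) ((p ^ k : ℕ) : ℤ)))
    (ha : ∀ k, (cofreeTorsionPow S ρ k).hom (a (k + 1)) = a k) :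
    ∃ t : Fin d → ↥(padicCoeffIntegers S), ∀ k, divPowCofreeMkTorsion S ρ k t = a k := by
  let C : ℕ → Set (Fin d → ↥(padicCoeffIntegers S)) := fun k ↦ divPowCofreeMkTorsion S ρ k ⁻¹' {a k}
  have hC : ∀ k t, t ∈ C k ↔ divPowCofreeMkTorsion S ρ k t = a k := fun k t ↦ Iff.rfl
  have hanti : ∀ k, C (k + 1) ⊆ C k := by
    intro k t ht
    rw [hC] at ht ⊢
    rw [← cofreeTorsionPow_divPowCofreeMkTorsion, ht, ha]
  have hne : ∀ k, (C k).Nonempty := fun k ↦ by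
    obtain ⟨t, ht⟩ := divPowCofreeMkTorsion_surjective S ρ k (a k)
    exact ⟨t, (hC k t).mpr ht⟩
  have hcl : ∀ k, IsClosed (C k) := fun k ↦
    (isClosed_discrete {a k}).preimage (continuous_divPowCofreeMkTorsion S ρ k)
  obtain ⟨t, ht⟩ := IsCompact.nonempty_iInter_of_sequence_nonempty_isCompact_isClosed C hanti hne
    (hcl 0).isCompact hcl
  exact ⟨t, fun k ↦ (hC k t).mp (Set.mem_iInter.mp ht k)⟩

/-- **COMP_ρ (separatedness): `t ∈ T_ρ = 𝒪ᵈ` all of whose residues `p^{-k} t mod 𝒪ᵈ` vanish is `0`** — `t ∈ ⋂_k p^k 𝒪ᵈ`, and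
`t = p^k s_k` for all `k` forces `t = lim_k p^k s_k = 0` (`UniversalNorms.tendsto_pow_smul_pi_padicCoeffIntegers`). The `proj_injective`
half of "`T_p = lim← A_p[p^k]`"; no compactness needed. [cite: Greenberg1989, §1 p. 98] [cite: Kato2004Asterisque, §13.8 (p. 228)] -/
theorem eq_zero_of_forall_divPowCofreeMkTorsion_eq_zero (t : Fin d → ↥(padicCoeffIntegers S))
    (h : ∀ k, divPowCofreeMkTorsion S ρ k t = 0) : t = 0 := by
  have hmem : ∀ k i, t i ∈ Ideal.span {((p : ↥(padicCoeffIntegers S))) ^ k} := fun k ↦ by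
    refine (divPowCofreeMk_eq_zero_iff S ρ k t).mp ?_
    simpa only [coe_divPowCofreeMkTorsion_apply, ZeroMemClass.coe_zero] using congrArg Subtype.val (h k)
  choose s hs using fun k i ↦ Ideal.mem_span_singleton'.mp (hmem k i)
  have hconst : (fun k ↦ ((p : ↥(padicCoeffIntegers S)) ^ k) • (fun i ↦ s k i)) = fun _ ↦ t := by
    funext k
    funext i
    rw [Pi.smul_apply, smul_eq_mul, mul_comm]
    exact hs k i
  have h0 := UniversalNorms.tendsto_pow_smul_pi_padicCoeffIntegers S (fun k i ↦ s k i)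
  rw [hconst] at h0
  exact tendsto_nhds_unique tendsto_const_nhds h0

/-- Two elements of `T_ρ` with the same residues `p^{-k}(·) mod 𝒪ᵈ` for all `k` are equal. [cite: Greenberg1989, §1 p. 98] -/
theorem eq_of_forall_divPowCofreeMkTorsion_eq (t t' : Fin d → ↥(padicCoeffIntegers S))
    (h : ∀ k, divPowCofreeMkTorsion S ρ k t = divPowCofreeMkTorsion S ρ k t') : t = t' :=
  sub_eq_zero.mp (eq_zero_of_forall_divPowCofreeMkTorsion_eq_zero S ρ (t - t') fun k ↦ by rw [map_sub, h k, sub_self])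

/-! ## §2 Continuity through the residues -/

/-- `‖p‖ < 1` in `ℚ̄_p` (private helper). [folklore] -/
private theorem norm_natCast_p_lt_one : ‖(p : PadicAlgCl p)‖ < 1 := by
  have hp : (p : ℕ).Prime := Fact.out
  rw [← map_natCast (algebraMap ℚ_[p] (PadicAlgCl p)), PadicAlgCl.norm_extends, Padic.norm_p]
  exact inv_lt_one_of_one_lt₀ (by exact_mod_cast hp.one_lt)

/-- **A map into `T_ρ = 𝒪ᵈ` all of whose residues `p^{-k}(·) mod 𝒪ᵈ` are continuous is continuous**: where the `k`-th residue is
constant the values differ by an element of `p^k 𝒪ᵈ` (`divPowCofreeMk_eq_iff`), of norm `≤ ‖p‖^k → 0`. (The topology of `T_ρ` IS the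
inverse-limit topology of the discrete `A_ρ[p^k]`.) [cite: SerreLocalFields1979, II §1] [cite: NeukirchSchmidtWingberg2008, II §7 (2.7.5)] -/
theorem continuous_of_forall_continuous_divPowCofreeMkTorsion_comp {Y : Type*} [TopologicalSpace Y]
    (f : Y → (Fin d → ↥(padicCoeffIntegers S))) (hf : ∀ k, Continuous fun y ↦ divPowCofreeMkTorsion S ρ k (f y)) :
    Continuous f := by
  refine continuous_pi fun i ↦ ?_
  rw [Topology.IsInducing.subtypeVal.continuous_iff]
  refine continuous_iff_continuousAt.2 fun y₀ ↦ Metric.tendsto_nhds.2 fun ε hε ↦ ?_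
  obtain ⟨k, hk⟩ := exists_pow_lt_of_lt_one hε (norm_natCast_p_lt_one (p := p))
  have hV : ∀ᶠ y in 𝓝 y₀, divPowCofreeMkTorsion S ρ k (f y) = divPowCofreeMkTorsion S ρ k (f y₀) :=
    ((isOpen_discrete ({divPowCofreeMkTorsion S ρ k (f y₀)} : Set _)).preimage (hf k)).mem_nhds rfl
  refine hV.mono fun y hy ↦ ?_
  have hy' : divPowCofreeMk S ρ k (f y) = divPowCofreeMk S ρ k (f y₀) := by
    simpa only [coe_divPowCofreeMkTorsion_apply] using congrArg Subtype.val hy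
  obtain ⟨s, hs⟩ := Ideal.mem_span_singleton'.mp ((divPowCofreeMk_eq_iff S ρ k (f y) (f y₀)).mp hy' i)
  change dist (((f y i : ↥(padicCoeffIntegers S)) : PadicAlgCl p)) (((f y₀ i : ↥(padicCoeffIntegers S)) : PadicAlgCl p)) < ε
  have hs' := congrArg (fun x : ↥(padicCoeffIntegers S) ↦ (x : PadicAlgCl p)) hs
  simp only [Subring.coe_mul, Subring.coe_pow, Subring.coe_natCast, AddSubgroupClass.coe_sub] at hs'
  rw [dist_eq_norm, ← hs', norm_mul, norm_pow]
  calc ‖(s : PadicAlgCl p)‖ * ‖(p : PadicAlgCl p)‖ ^ k ≤ 1 * ‖(p : PadicAlgCl p)‖ ^ k :=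
        mul_le_mul_of_nonneg_right s.2.2 (pow_nonneg (norm_nonneg _) _)
    _ < ε := by rw [one_mul]; exact hk

/-! ## §3 Exact lifting of representatives along a tower with surjective transition maps (generic) -/

section Tower

universe u

variable {G : Type u} [Group G] [TopologicalSpace G] [IsTopologicalGroup G]

/-- **Exact lifting of cocycle representatives along an `ℕ`-tower** (the cochain-level content of NSW Thm. (2.7.5) in degree one):
for topological `G`-modules `X_k` with continuous orbit maps, transition morphisms `π_k : X_{k+1} ⟶ X_k` that are ONTO, and classes
`c_k ∈ H¹(G, X_k)` with `(π_k)_* c_{k+1} = c_k`, there are continuous crossed homomorphisms `φ_k` representing the `c_k` with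
`π_k ∘ φ_{k+1} = φ_k` ON THE NOSE (lift representatives level by level and correct by the principal crossed homomorphism of a lift of
the bounding element). Generic: no coefficient ring, no number theory. [cite: NeukirchSchmidtWingberg2008, II §7 Thm. 2.7.5]
[cite: SerreGaloisCohomology1997, I §5.1] -/
theorem exists_contOneCocycles_tower_of_compatible (X : ℕ → TopRep.{u} ℤ G)
    (hX : ∀ (k : ℕ) (v : X k), Continuous fun g : G ↦ (X k).ρ g v)
    (π : ∀ k : ℕ, X (k + 1) ⟶ X k) (hπ : ∀ k, Function.Surjective (π k).hom)
    (c : ∀ k : ℕ, continuousCohomology 1 (X k)) (hc : ∀ k, cohomologyMap (π k) 1 (c (k + 1)) = c k) :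
    ∃ φ : ∀ k : ℕ, contOneCocycles (X k),
      (∀ k, oneCocycleClass _ (φ k) = c k) ∧ ∀ (k : ℕ) (g : G), (π k).hom ((φ (k + 1)).1 g) = (φ k).1 g := by
  classical
  -- representatives
  choose g hg using fun k ↦ oneCocycleClass_surjective (X k) (c k)
  -- representatives with prescribed class …
  let T : ℕ → Type u := fun k ↦ {f : contOneCocycles (X k) // oneCocycleClass _ f = c k}
  -- … can be lifted EXACTLY along `π`
  have hstep : ∀ (k : ℕ) (t : T k), ∃ t' : T (k + 1), ∀ s : G, (π k).hom (t'.1.1 s) = t.1.1 s := by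
    intro k t
    -- `π_k ∘ g_{k+1}` represents `c_k`
    obtain ⟨red, hred, h1⟩ : ∃ red : contOneCocycles (X k),
        (∀ s : G, red.1 s = (π k).hom ((g (k + 1)).1 s)) ∧ oneCocycleClass _ red = c k :=
      ⟨contOneCocycles.pullback (ContinuousMonoidHom.id G) (resIdHom (π k)) (g (k + 1)), fun s ↦ rfl,
        by rw [← cohomologyMap_oneCocycleClass, hg, hc]⟩
    have h0 : oneCocycleClass _ (red - t.1) = 0 := by
      rw [oneCocycleClass_sub, h1, t.2, sub_self]
    obtain ⟨v, hv⟩ := (oneCocycleClass_eq_zero_iff _ _).1 h0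
    obtain ⟨v', hv'⟩ := hπ k v
    -- the principal crossed homomorphism of `v'` at level `k + 1`
    let b : contOneCocycles (X (k + 1)) :=
      ⟨⟨fun s ↦ (X (k + 1)).ρ s v' - v', (hX (k + 1) v').sub continuous_const⟩, fun s s' ↦ by
          change (X (k + 1)).ρ (s * s') v' - v' = (X (k + 1)).ρ s v' - v' + (X (k + 1)).ρ s ((X (k + 1)).ρ s' v' - v')
          rw [map_mul, mul_apply_eq_comp, map_sub]
          abel⟩
    have hb : oneCocycleClass _ b = 0 := (oneCocycleClass_eq_zero_iff _ _).2 ⟨v', fun s ↦ rfl⟩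
    refine ⟨⟨g (k + 1) - b, by rw [oneCocycleClass_sub, hb, sub_zero, hg]⟩, fun s ↦ ?_⟩
    have hvs := hv s
    rw [Submodule.coe_sub, ContinuousMap.sub_apply, hred] at hvs
    change (π k).hom ((g (k + 1)).1 s - ((X (k + 1)).ρ s v' - v')) = t.1.1 s
    rw [map_sub, map_sub, TopRep.hom_comm_apply (π k) s v', hv', ← hvs]
    abel
  choose step hstep using hstep
  let F : ∀ k, T k := fun k ↦ Nat.rec (motive := T) ⟨g 0, hg 0⟩ (fun k t ↦ step k t) k
  exact ⟨fun k ↦ (F k).1, fun k ↦ (F k).2, fun k s ↦ hstep k (F k) s⟩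

end Tower

/-! ## §4 Rubin B.2.3, surjectivity half: compatible families of classes lift to `H¹(U, T_ρ)` -/

/-- **Rubin, *Euler Systems*, Prop. B.2.3 / NSW Thm. (2.7.5) in degree one for `T_ρ = lim←_k A_ρ[p^k]` (surjectivity half):
`H¹(U, T_ρ) → lim←_k H¹(U, A_ρ[p^k])` is ONTO** — the sketch's `CofreeReductionLimSurjective S ρ U` (H-C, LIM_ρ), for compact `𝒪`.
For every subgroup `U ≤ Γ_ℚ` and every family of classes `c_k ∈ H¹(U, A_ρ[p^k])` compatible under
`[p]_* : H¹(U, A_ρ[p^{k+1}]) → H¹(U, A_ρ[p^k])` (`cohomologyMap (subgroupRepMap (cofreeTorsionPow S ρ k) U) 1`) there is a class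
`x ∈ H¹(U, T_ρ)` whose reduction `red_{p^k} x` (`GreenbergSelmer.reduceH1CofreePkTorsion`, read in the `H1 (cofreeTorsionGaloisModule …) U`
dialect) is `c_k` for every `k`. Proof on continuous cochains: representatives `φ_k` with `[p] ∘ φ_{k+1} = φ_k` on the nose (§3,
`[p] : A_ρ[p^{k+1}] → A_ρ[p^k]` is onto); the componentwise limit `u ↦ lim_k φ_k(u) ∈ 𝒪ᵈ` (§1) is a continuous (§2) crossed
homomorphism (uniqueness in §1). The kernel is `0`: `GreenbergSelmer.eq_of_forall_reduceH1CofreePkTorsion_eq`.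
[cite: Rubin2000, App. B Prop. B.2.3] [cite: NeukirchSchmidtWingberg2008, II §7 Thm. 2.7.5] [cite: Kato2004Asterisque, §8.2 (p. 181)] -/
theorem exists_forall_reduceH1CofreePkTorsion_eq_of_compatible [CompactSpace ↥(padicCoeffIntegers S)]
    (U : Subgroup (absoluteGaloisGroup ℚ))
    (c : ∀ k : ℕ, H1 (cofreeTorsionGaloisModule S ρ ((p ^ k : ℕ) : ℤ)) U)
    (hc : ∀ k, cohomologyMap (subgroupRepMap (cofreeTorsionPow S ρ k) U) 1 (c (k + 1)) = c k) :
    ∃ x : H1 (FramedGaloisRep.toGaloisRep ρ) U, ∀ k,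
      (reduceH1CofreePkTorsion S ρ k U x : H1 (cofreeTorsionGaloisModule S ρ ((p ^ k : ℕ) : ℤ)) U) = c k := by
  classical
  -- representatives `φ_k` of the `c_k` with `[p] ∘ φ_{k+1} = φ_k` on the nose
  obtain ⟨φ, hφc, hφ⟩ := exists_contOneCocycles_tower_of_compatible
    (fun k ↦ subgroupRep (cofreeTorsionGaloisModule S ρ ((p ^ k : ℕ) : ℤ)).toTopRep U)
    (fun k v ↦ ((cofreeTorsionGaloisModule S ρ ((p ^ k : ℕ) : ℤ)).continuous_apply_left v).comp continuous_subtype_val)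
    (fun k ↦ subgroupRepMap (cofreeTorsionPow S ρ k) U) (fun k ↦ exists_cofreeTorsionPow_hom_eq S ρ k) c hc
  -- the componentwise limit `u ↦ lim_k φ_k(u)` in `T_ρ = 𝒪ᵈ`
  choose Φv hΦv using fun u : U ↦
    exists_forall_divPowCofreeMkTorsion_eq_of_compatible S ρ (fun k ↦ (φ k).1 u) (fun k ↦ hφ k u)
  have hΦcont : Continuous Φv :=
    continuous_of_forall_continuous_divPowCofreeMkTorsion_comp S ρ Φv fun k ↦
      (φ k).1.continuous.congr fun u ↦ (hΦv u k).symm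
  -- it is a crossed homomorphism: all its residues are
  let Φ : contOneCocycles (subgroupRep (FramedGaloisRep.toGaloisRep ρ).toTopRep U) :=
    ⟨⟨Φv, hΦcont⟩, fun u u' ↦ by
      refine eq_of_forall_divPowCofreeMkTorsion_eq S ρ _ _ fun k ↦ ?_
      change divPowCofreeMkTorsion S ρ k (Φv (u * u')) =
        divPowCofreeMkTorsion S ρ k (Φv u + (subgroupRep (FramedGaloisRep.toGaloisRep ρ).toTopRep U).ρ u (Φv u'))
      rw [map_add, divPowCofreeMkTorsion_subgroupRep, hΦv, hΦv, hΦv]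
      exact (φ k).2 u u'⟩
  refine ⟨oneCocycleClass _ Φ, fun k ↦ ?_⟩
  -- `red_{p^k} [Φ] = [div_k ∘ Φ] = [φ_k] = c_k` (explicit `Eq.trans` chain: no `rfl` attempts at the concrete torsion module)
  have hΦk : contOneCocycles.pushAddHom (X := subgroupRep (FramedGaloisRep.toGaloisRep ρ).toTopRep U)
      (Y := subgroupRep (cofreeTorsionGaloisModule S ρ ((p ^ k : ℕ) : ℤ)).toTopRep U)
      (divPowCofreeMkTorsion S ρ k) (continuous_divPowCofreeMkTorsion S ρ k) (divPowCofreeMkTorsion_subgroupRep S ρ k U) Φ = φ k :=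
    Subtype.ext (ContinuousMap.ext fun u ↦ hΦv u k)
  exact (reduceH1CofreePkTorsion_oneCocycleClass' S ρ k U Φ).trans ((congrArg (oneCocycleClass _) hΦk).trans (hφc k))

/-- **H-C under the newform habitat's standing hypothesis** `[FiniteDimensional ℚ_[p] ℚ_p(S)]` (then `𝒪` is compact,
`UniversalNorms.compactSpace_padicCoeffIntegers`): `H¹(U, T_ρ) → lim←_k H¹(U, A_ρ[p^k])` is onto. [cite: Rubin2000, App. B Prop. B.2.3]
[cite: NeukirchSchmidtWingberg2008, II §7 Thm. 2.7.5] -/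
theorem exists_forall_reduceH1CofreePkTorsion_eq_of_compatible_of_finiteDimensional
    [FiniteDimensional ℚ_[p] ↥(padicCoeffField S)] (U : Subgroup (absoluteGaloisGroup ℚ))
    (c : ∀ k : ℕ, H1 (cofreeTorsionGaloisModule S ρ ((p ^ k : ℕ) : ℤ)) U)
    (hc : ∀ k, cohomologyMap (subgroupRepMap (cofreeTorsionPow S ρ k) U) 1 (c (k + 1)) = c k) :
    ∃ x : H1 (FramedGaloisRep.toGaloisRep ρ) U, ∀ k,
      (reduceH1CofreePkTorsion S ρ k U x : H1 (cofreeTorsionGaloisModule S ρ ((p ^ k : ℕ) : ℤ)) U) = c k :=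
  haveI := UniversalNorms.compactSpace_padicCoeffIntegers S
  exists_forall_reduceH1CofreePkTorsion_eq_of_compatible S ρ U c hc

set_option maxHeartbeats 800000 in
-- the statement coerces `subgroupH1 U A_ρ[p^{k+1}]` into the `H1 (cofreeTorsionGaloisModule …) U` dialect at the level `p^(k+1)`
-- (definitional, `CyclotomicLayer.subgroupH1_cofreeTorsionBy_eq`), which is slow to unify (cf. `layerLocOf_reduce_succ`)
/-- **The reductions of ONE class form a `[p]_*`-compatible family**: `[p]_* (red_{p^{k+1}} x) = red_{p^k} x` in `H¹(U, A_ρ[p^k])`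
(`[p] ∘ div_{k+1} = div_k` on cocycles) — the converse direction, so that the image of `x ↦ (red_{p^k} x)_k` IS the set of compatible
families (the global twin of `layerLocOf_reduce_succ`). [cite: Kato2004Asterisque, §13.8 (p. 228)] [cite: Rubin2000, App. B Prop. B.2.3] -/
theorem cohomologyMap_cofreeTorsionPow_reduceH1CofreePkTorsion_succ (k : ℕ) (U : Subgroup (absoluteGaloisGroup ℚ))
    (x : H1 (FramedGaloisRep.toGaloisRep ρ) U) :
    cohomologyMap (subgroupRepMap (cofreeTorsionPow S ρ k) U) 1
        (reduceH1CofreePkTorsion S ρ (k + 1) U x : H1 (cofreeTorsionGaloisModule S ρ ((p ^ (k + 1) : ℕ) : ℤ)) U) =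
      (reduceH1CofreePkTorsion S ρ k U x : H1 (cofreeTorsionGaloisModule S ρ ((p ^ k : ℕ) : ℤ)) U) := by
  obtain ⟨φ, rfl⟩ := oneCocycleClass_surjective _ x
  refine ((congrArg (fun y : H1 (cofreeTorsionGaloisModule S ρ ((p ^ (k + 1) : ℕ) : ℤ)) U ↦
      cohomologyMap (subgroupRepMap (cofreeTorsionPow S ρ k) U) 1 y)
    (reduceH1CofreePkTorsion_oneCocycleClass' S ρ (k + 1) U φ)).trans ?_).trans
    (reduceH1CofreePkTorsion_oneCocycleClass' S ρ k U φ).symm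
  refine (cohomologyMap_oneCocycleClass _ _).trans (congrArg (oneCocycleClass _) (Subtype.ext (ContinuousMap.ext fun u ↦ ?_)))
  exact cofreeTorsionPow_divPowCofreeMkTorsion S ρ k (φ.1 u)

end Summit.BirchSwinnertonDyer.BirchSwinnertonDyer.Theorems.ThetaTransport

end
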